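import Summits.QuantumFields.GaugeBoot.TiltedBoxLimitInvariance
import Summits.QuantumFields.GaugeBoot.ClassBRPClosure
import HarnessLib

/-!
# Infinite-volume limit points of the 45°-tilted boxes, part 4: DIAGONAL reflection positivity

HONEST FRAMING (cell `pub-gaugeboot`, page 1 of every file): the venture produces certified bounds
on lattice expectations at stated coupling, gauge group, dimension and torus size; NOT a mass gap,
NOT a continuum limit, NOT a string tension; NOT Yang–Mills-summit-bearing (barriers
`FixedCouplingUltralocality`, `PerturbativeInvisibility`). This module proves a structural POSITIVE
fact about a class of infinite-volume Wilson states (which positivity blocks are exact for them);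
it discharges nothing else.

## Content

**`diagRP_of_mem_tiltedBoxLimitPoints`.** For a compact Hausdorff second countable group `G`, a
continuous representation `ρ`, `β ≥ 0` and `i ≠ j`: every tilted limit point
`μ ∈ tiltedBoxLimitPoints d i j ρ β` (weak limits of the Wilson states of the square 45°-tilted
boxes `ℤ^d/Γ(M_k + 2, M_k + 2, 2(Q_k + 2))`, `M_k, Q_k → ∞`) is REFLECTION POSITIVE in the diagonal
hyperplane `x_i = x_j` in the sense of `ClassB.lean`:
`IsReflectionPositiveFor (configDiagSwapZd i j) (diagHalfEdges i j) μ` — `0 ≤ ∫ conj F(ΘU) F(U) dμ`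
for every bounded measurable `F` depending only on the links of the closed half `{x_i ≥ x_j}`.
Hence (`diagBlock_nonneg_of_mem_tiltedBoxLimitPoints`) the bootstrap's diagonal positivity
matrices `(∫ conj(F_a ∘ Θ) F_b dμ)_{a,b}` — Kazakov–Zheng's third reflection-positivity family
(arXiv:2203.11360 §3.1, arXiv:2404.16925 §3.2) — are positive semidefinite for EVERY tilted limit
point, at every `β ≥ 0`, in every dimension, WITHOUT any uniqueness hypothesis.

This is the infinite-volume form of `tiltedBox_diagonalRP` (`TiltedBox.lean`) and the contrast with
the cubic tori: their limit points `infiniteVolumeLimitPoints ρ β` are diagonal-RP only where this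
is separately known (`TorusLimitPointsDiagonalRP`, OPEN for `d ≥ 3` beyond the uniqueness regime;
the cubic tori themselves are never diagonal-RP, `DiagonalRPTorusNegative.lean`), whereas the tilted
boxes carry the diagonal mirror at every finite size and pass it to all their limit points.

Proof: reduce to bounded continuous cylinder observables (`IsReflectionPositiveFor.of_continuous_cylinder`,
`ClassBRPClosure.lean`; `μ` is `Θ`-invariant by `TiltedBoxLimitInvariance.lean`); a cylinder
observable of the half with `x_i - x_j ≤ m` on its support lifts to a closed-half observable of every
box with `M_v ≥ m + 1` (`isHalfObservable_diag_comp_tiltedLift`), the lift intertwines the mirrors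
(`tiltedLift_configSwap`), so the box pairings are `≥ 0` by `tiltedBox_diagonalRP` and so is their
limit (`IsTiltedBoxLimitAlong.integral_nonneg_of_eventually`).

References: J. Fröhlich, R. Israel, E. H. Lieb, B. Simon, J. Stat. Phys. 22 (1980) 297, §3;
K. Osterwalder, E. Seiler, Ann. Phys. 110 (1978) 440, §2; S. Friedli, Y. Velenik (2017) Ch. 10;
V. Kazakov, Z. Zheng, arXiv:2203.11360 §3.1, arXiv:2404.16925 §3.2.
-/

noncomputable section

open MeasureTheory Filter Topology
open scoped ComplexOrder ComplexConjugate
open Literature.Probability.LatticeModels (Site)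
open Literature.MathematicalPhysics.QuantumLattice

namespace Summit.QuantumFields.GaugeBoot

namespace TiltedRP

variable {d : ℕ} {i j : Fin d} {N : ℕ}
variable {G : Type*} [Group G] [TopologicalSpace G] [IsTopologicalGroup G] [CompactSpace G]
  [MeasurableSpace G] [BorelSpace G] [SecondCountableTopology G]
variable (ρ : G →* Matrix (Fin N) (Fin N) ℂ)

/-- **Box step**: the diagonal RP pairing of the lift of a bounded measurable cylinder observable of
the closed half `{x_i ≥ x_j}` with `x_i - x_j ≤ m` on its support is non-negative on every box with
`M_v ≥ m + 1`, `M_v ≥ 2` (`tiltedBox_diagonalRP`). -/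
theorem box_diagRP_nonneg {Mu Mv L : ℕ} [NeZero Mu] [NeZero Mv] [NeZero L] (hij : i ≠ j)
    (hMv : 2 ≤ Mv) (hρ : Continuous ρ) {β : ℝ} (hβ : 0 ≤ β) {F : LGConfig d G → ℂ}
    {T : Finset (ZdEdge d)} (hFT : IsCylinder F T) (hFm : Measurable F) {C : ℝ}
    (hC : ∀ U, ‖F U‖ ≤ C) (hT : ∀ e ∈ T, e ∈ diagHalfEdges i j) {m : ℕ}
    (hTm : ∀ e ∈ T, e.1 i - e.1 j ≤ m) (hm : m + 1 ≤ Mv) :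
    0 ≤ ∫ U, conj (F (configDiagSwapZd i j (tiltedLift d i j Mu Mv L U))) * F (tiltedLift d i j Mu Mv L U)
      ∂(gibbs ρ (tiltedUnit d i j Mu Mv L) β) := by
  have hpos := tiltedBox_diagonalRP ρ hij hMv hρ hβ (fun U => F (tiltedLift d i j Mu Mv L U))
    (hFm.comp (measurable_tiltedLift d i j Mu Mv L)) ⟨C, fun U => hC _⟩
    (isHalfObservable_diag_comp_tiltedLift hFT hT hTm hm)
  simpa only [tiltedLift_configSwap] using hpos

/-- **The diagonal RP pairing of a tilted limit point is non-negative on continuous cylinder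
observables of the half** (the limit of `box_diagRP_nonneg` along the defining family). -/
theorem integral_diagSwap_nonneg_of_cylinder (hij : i ≠ j) (hρ : Continuous ρ) {β : ℝ} (hβ : 0 ≤ β)
    {μ : Measure (LGConfig d G)} (hμ : μ ∈ tiltedBoxLimitPoints d i j ρ β)
    {F : LGConfig d G → ℂ} {T : Finset (ZdEdge d)} (hFT : IsCylinder F T) (hFc : Continuous F)
    {C : ℝ} (hC : ∀ U, ‖F U‖ ≤ C) (hFS : DependsOn F (diagHalfEdges i j)) :
    0 ≤ ∫ U, conj (F (configDiagSwapZd i j U)) * F U ∂μ := by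
  classical
  obtain ⟨M, Q, hM, -, h⟩ := hμ
  -- support inside the half, with bounded diagonal coordinate
  set T' : Finset (ZdEdge d) := T.filter (· ∈ diagHalfEdges (d := d) i j) with hT'
  have hFT' : IsCylinder F T' := isCylinder_filter_of_dependsOn hFT hFS
  have hTh : ∀ e ∈ T', e ∈ diagHalfEdges i j := fun e he => (Finset.mem_filter.1 he).2
  obtain ⟨m, hm⟩ : ∃ m : ℕ, ∀ e ∈ T', e.1 i - e.1 j ≤ m := by
    refine ⟨T'.sup fun e => (e.1 i - e.1 j).toNat, fun e he => ?_⟩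
    have hle := Finset.le_sup (f := fun e : ZdEdge d => (e.1 i - e.1 j).toNat) he
    have : (e.1 i - e.1 j).toNat ≤ T'.sup fun e : ZdEdge d => (e.1 i - e.1 j).toNat := hle
    omega
  -- the pairing observable
  set H : LGConfig d G → ℂ := fun U => conj (F (configDiagSwapZd i j U)) * F U with hH
  have hHc : Continuous H :=
    (Complex.continuous_conj.comp (hFc.comp (continuous_configDiagSwapZd i j))).mul hFc
  have hHcyl : IsCylinder H
      (T.image (fun e => (zdDiagSwap i j e.1, Equiv.swap i j e.2)) ∪ T) := by
    intro U V hUV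
    have e1 := isCylinder_comp_configDiagSwapZd hFT i j fun e he => hUV e (by
      rw [Finset.coe_union]; exact Or.inl he)
    have e2 := hFT fun e he => hUV e (by rw [Finset.coe_union]; exact Or.inr he)
    simp only [Function.comp_apply] at e1
    simp only [hH, e1, e2]
  have hHb : ∀ U, ‖H U‖ ≤ C * C := fun U => by
    simp only [hH, norm_mul, Complex.norm_conj]
    exact mul_le_mul (hC _) (hC _) (norm_nonneg _) ((norm_nonneg (F U)).trans (hC U))
  refine h.integral_nonneg_of_eventually hρ hHcyl hHc hHb ?_
  have hev : ∀ᶠ k in atTop, m ≤ M k := hM.eventually_ge_atTop m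
  refine hev.mono fun k hk => ?_
  exact box_diagRP_nonneg ρ hij (by omega) hρ hβ hFT' hFc.measurable hC hTh hm (by omega)

variable [T2Space G]

/-- **Diagonal reflection positivity of every tilted limit point** (`β ≥ 0`, `i ≠ j`): the `diagRP`
field of `ClassBState` for the pair `(i, j)` — all bounded measurable observables of the closed half
`{x_i ≥ x_j}`. -/
theorem diagRP_of_mem_tiltedBoxLimitPoints (hij : i ≠ j) (hρ : Continuous ρ) {β : ℝ} (hβ : 0 ≤ β)
    {μ : Measure (LGConfig d G)} (hμ : μ ∈ tiltedBoxLimitPoints d i j ρ β) :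
    IsReflectionPositiveFor (configDiagSwapZd (G := G) i j) (diagHalfEdges i j) μ := by
  haveI := isProbabilityMeasure_of_mem_tiltedBoxLimitPoints hμ
  exact IsReflectionPositiveFor.of_continuous_cylinder
    (measurePreserving_configDiagSwapZd_of_mem_tiltedBoxLimitPoints ρ hij hρ hμ)
    fun F T hFT hFc ⟨C, hC⟩ hFS => integral_diagSwap_nonneg_of_cylinder ρ hij hρ hβ hμ hFT hFc hC hFS

/-- **The diagonal RP blocks of a tilted limit point are positive semidefinite**: for bounded
measurable half-space observables `F_1, …, F_n` and `c ∈ ℂ^n`,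
`0 ≤ ∑_{a,b} conj c_a · c_b · ∫ conj(F_a(ΘU)) F_b(U) dμ` — Kazakov–Zheng's third positivity family is
an exact constraint on every tilted limit point (`β ≥ 0`). -/
theorem diagBlock_nonneg_of_mem_tiltedBoxLimitPoints (hij : i ≠ j) (hρ : Continuous ρ) {β : ℝ}
    (hβ : 0 ≤ β) {μ : Measure (LGConfig d G)} (hμ : μ ∈ tiltedBoxLimitPoints d i j ρ β) {n : ℕ}
    (F : Fin n → LGConfig d G → ℂ) (hF : ∀ a, Measurable (F a))
    (hFb : ∀ a, ∃ C : ℝ, ∀ U, ‖F a U‖ ≤ C) (hFS : ∀ a, DependsOn (F a) (diagHalfEdges i j))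
    (c : Fin n → ℂ) :
    0 ≤ ∑ a, ∑ b, conj (c a) * c b * ∫ U, conj (F a (configDiagSwapZd i j U)) * F b U ∂μ := by
  haveI := isProbabilityMeasure_of_mem_tiltedBoxLimitPoints hμ
  exact (diagRP_of_mem_tiltedBoxLimitPoints ρ hij hρ hβ hμ).sum_mul_conj_nonneg
    DiagRP.measurable_configDiagSwapZd F hF hFb hFS c

end TiltedRP

end Summit.QuantumFields.GaugeBoot
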